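import Literature.Probability.RandomPlanarGeometry.SAWRatioLimit
import HarnessLib

/-!
# Kesten's ratio lemma with ONE step: `a_{N+1}/a_N → μ` (Madras–Slade Lemma 7.3.1, step `2 ↦ 1`)

Topic `Literature/Probability/RandomPlanarGeometry` (continues `SAWRatioLimit.lean`: `Zd.tendsto_ratio_of_kesten` — Lemma 7.3.1
of Madras–Slade with the printed two-step ratio `φ_N = a_{N+2}/a_N`).

Source: N. Madras, G. Slade, *The Self-Avoiding Walk* (1993), Lemma 7.3.1 (stated p. 242) and the Remark on p. 244 (which prints
«Lemma 7.3.2» [sic] for Lemma 7.3.1): on lattices with odd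
cycles "we can modify our argument easily" to treat `c_{N+1}/c_N`; the modification of the analytic LEMMA is the statement below
("apparent" in print; never written out — lane «pcv-sawmu» door census (iii-𝕋), piece K4 = a-idea-1's face `KestenLemmaOneStep`).

THE ONE-STEP LEMMA IS A COROLLARY OF THE TWO-STEP ONE: for `ã_n := a_{⌊n/2⌋}` one has `ã_{n+2}/ã_n = φ_{⌊n/2⌋}` with
`φ_N := a_{N+1}/a_N`, `ã_n^{1/n} → μ^{1/2}`, hypothesis (ii) transfers verbatim and (iii) with `D ↦ 3 max(D,0)`
(`⌊n/2⌋ ≥ n/3` for `n ≥ 2`); the tree lemma gives `φ_{⌊n/2⌋} → (μ^{1/2})² = μ`, read along `n = 2N`.  No iteration is re-proved.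

## What is here (namespace `Literature.Probability.RandomPlanarGeometry.SAW.Zd`; all proved, axioms standard)

* **`tendsto_ratio_of_kesten_one`** — `a_N > 0`, `a_N^{1/N} → μ > 0`, `a_{N+1}/a_N ≥ c > 0` eventually,
  `φ_N² − D/N ≤ φ_N φ_{N+1}` eventually ⇒ `a_{N+1}/a_N → μ`.
-/

noncomputable section

open Filter Topology

namespace Literature.Probability.RandomPlanarGeometry.SAW.Zd

/-- `n ↦ n / 2` tends to infinity. [folklore] -/
private theorem tendsto_div_two_atTop : Tendsto (fun n : ℕ => n / 2) atTop atTop :=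
  tendsto_atTop_atTop.2 fun b => ⟨2 * b, fun n hn => by omega⟩

/-- `((n/2 : ℕ) : ℝ) / n → 1/2`. [folklore] -/
private theorem tendsto_div_two_div : Tendsto (fun n : ℕ => (((n / 2 : ℕ) : ℝ)) / (n : ℝ)) atTop (𝓝 (1 / 2)) := by
  -- squeeze between `1/2 - 1/n` and `1/2`
  have hup : ∀ n : ℕ, (((n / 2 : ℕ) : ℝ)) / (n : ℝ) ≤ 1 / 2 := by
    intro n
    rcases Nat.eq_zero_or_pos n with rfl | hn
    · simp
    · rw [div_le_iff₀ (by exact_mod_cast hn)]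
      have : ((n / 2 : ℕ) : ℝ) * 2 ≤ n := by exact_mod_cast (Nat.div_mul_le_self n 2)
      linarith
  have hlo : ∀ᶠ n : ℕ in atTop, 1 / 2 - 1 / (n : ℝ) ≤ (((n / 2 : ℕ) : ℝ)) / (n : ℝ) := by
    filter_upwards [eventually_ge_atTop 1] with n hn
    have hn0 : (0 : ℝ) < n := by exact_mod_cast hn
    have key : (n : ℝ) / 2 - 1 ≤ ((n / 2 : ℕ) : ℝ) := by
      have : n ≤ 2 * (n / 2) + 1 := by omega
      have : (n : ℝ) ≤ 2 * ((n / 2 : ℕ) : ℝ) + 1 := by exact_mod_cast this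
      linarith
    have e : (1 : ℝ) / 2 - 1 / (n : ℝ) = ((n : ℝ) / 2 - 1) / n := by
      field_simp
    rw [e]
    exact div_le_div_of_nonneg_right key hn0.le
  have hlim : Tendsto (fun n : ℕ => (1 : ℝ) / 2 - 1 / (n : ℝ)) atTop (𝓝 (1 / 2)) := by
    have := tendsto_const_nhds (x := (1 : ℝ) / 2) (f := (atTop : Filter ℕ)) |>.sub tendsto_one_div_atTop_nhds_zero_nat
    simpa using this
  exact tendsto_of_tendsto_of_tendsto_of_le_of_le' hlim tendsto_const_nhds hlo (Eventually.of_forall hup)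

/-- **Kesten's ratio lemma, one-step form** (Madras–Slade Lemma 7.3.1 with `N+2 ↦ N+1`, the modification called "apparent" on
p. 244). Let `a_N > 0` and `φ_N = a_{N+1}/a_N`. Assume (i) `a_N^{1/N} → μ > 0`, (ii) `φ_N ≥ c` for some `c > 0` and all large `N`,
(iii) there is `D` with `φ_N φ_{N+1} ≥ φ_N² − D/N` for all large `N`. Then `φ_N → μ`.  Proof: the two-step lemma
`tendsto_ratio_of_kesten` for `ã_n := a_{⌊n/2⌋}` (`ã_{n+2}/ã_n = φ_{⌊n/2⌋}`, `ã_n^{1/n} → μ^{1/2}`, `D ↦ 3 max(D,0)`), then `n = 2N`.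
[cite: MadrasSlade1993, Lemma 7.3.1 (p. 242) and Remark p. 244 («Lemma 7.3.2» [sic])] -/
theorem tendsto_ratio_of_kesten_one {a : ℕ → ℝ} {μ : ℝ} (hμ : 0 < μ) (ha : ∀ n, 0 < a n)
    (hlim : Tendsto (fun n : ℕ => a n ^ (1 / (n : ℝ))) atTop (𝓝 μ))
    (hii : ∃ c : ℝ, 0 < c ∧ ∀ᶠ n in atTop, c ≤ a (n + 1) / a n)
    (hiii : ∃ D : ℝ, ∀ᶠ n in atTop,
      (a (n + 1) / a n) ^ 2 - D / n ≤ (a (n + 1) / a n) * (a (n + 2) / a (n + 1))) :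
    Tendsto (fun n : ℕ => a (n + 1) / a n) atTop (𝓝 μ) := by
  -- the doubled sequence
  set b : ℕ → ℝ := fun n => a (n / 2) with hb
  have hb0 : ∀ n, 0 < b n := fun n => ha _
  have hb2 : ∀ n, b (n + 2) = a (n / 2 + 1) := fun n => by
    simp only [hb]; congr 1; omega
  set ν : ℝ := μ ^ ((1 : ℝ) / 2) with hν
  have hν0 : 0 < ν := Real.rpow_pos_of_pos hμ _
  have hν2 : ν ^ 2 = μ := by
    rw [hν, ← Real.rpow_natCast, ← Real.rpow_mul hμ.le]; norm_num
  -- (i) for `b`: `b_n^{1/n} = (a_m^{1/m})^{m/n} → μ^{1/2}`, `m = ⌊n/2⌋`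
  have hlimb : Tendsto (fun n : ℕ => b n ^ (1 / (n : ℝ))) atTop (𝓝 ν) := by
    have h1 : Tendsto (fun n : ℕ => a (n / 2) ^ (1 / (((n / 2 : ℕ) : ℝ)))) atTop (𝓝 μ) :=
      hlim.comp tendsto_div_two_atTop
    have h2 : Tendsto (fun n : ℕ => (a (n / 2) ^ (1 / (((n / 2 : ℕ) : ℝ)))) ^ ((((n / 2 : ℕ) : ℝ)) / (n : ℝ)))
        atTop (𝓝 (μ ^ ((1 : ℝ) / 2))) :=
      h1.rpow tendsto_div_two_div (Or.inl hμ.ne')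
    refine (h2.congr' ?_)
    filter_upwards [eventually_ge_atTop 2] with n hn
    have hm0 : ((n / 2 : ℕ) : ℝ) ≠ 0 := by
      have : 1 ≤ n / 2 := by omega
      exact_mod_cast (show n / 2 ≠ 0 by omega)
    simp only [hb]
    rw [← Real.rpow_mul (ha _).le]
    congr 1
    field_simp
  -- (ii) for `b`
  have hiib : ∃ c : ℝ, 0 < c ∧ ∀ᶠ n in atTop, c ≤ b (n + 2) / b n := by
    obtain ⟨c, hc, hev⟩ := hii
    refine ⟨c, hc, ?_⟩
    have h := tendsto_div_two_atTop.eventually hev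
    filter_upwards [h] with n hn
    rw [hb2]
    exact hn
  -- (iii) for `b`, with `D ↦ 3 max(D,0)`
  have hiiib : ∃ D : ℝ, ∀ᶠ n in atTop,
      (b (n + 2) / b n) ^ 2 - D / n ≤ (b (n + 2) / b n) * (b (n + 4) / b (n + 2)) := by
    obtain ⟨D, hev⟩ := hiii
    refine ⟨3 * max D 0, ?_⟩
    have h := tendsto_div_two_atTop.eventually hev
    filter_upwards [h, eventually_ge_atTop 2] with n hn hn2
    have e4 : b (n + 4) = a (n / 2 + 2) := by simp only [hb]; congr 1; omega
    have e2 : b (n + 2) = a (n / 2 + 1) := hb2 n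
    rw [e4, e2]
    simp only [hb]
    -- `D / ⌊n/2⌋ ≤ 3 max(D,0) / n`
    have hm1 : (1 : ℝ) ≤ ((n / 2 : ℕ) : ℝ) := by exact_mod_cast (show 1 ≤ n / 2 by omega)
    have hn0 : (0 : ℝ) < n := by exact_mod_cast (show 0 < n by omega)
    have hmn : (n : ℝ) ≤ 3 * ((n / 2 : ℕ) : ℝ) := by exact_mod_cast (show n ≤ 3 * (n / 2) by omega)
    have hD : D / ((n / 2 : ℕ) : ℝ) ≤ 3 * max D 0 / n := by
      rw [div_le_div_iff₀ (by linarith) hn0]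
      have hD0 : D ≤ max D 0 := le_max_left _ _
      have hM0 : 0 ≤ max D 0 := le_max_right _ _
      nlinarith
    have e : (n / 2 + 1 + 1 : ℕ) = n / 2 + 2 := by omega
    have hn' : (a (n / 2 + 1) / a (n / 2)) ^ 2 - D / ((n / 2 : ℕ) : ℝ) ≤
        (a (n / 2 + 1) / a (n / 2)) * (a (n / 2 + 2) / a (n / 2 + 1)) := by
      simpa only [e] using hn
    linarith
  -- the two-step lemma for `b`, then read along `n = 2N`
  have hmain := tendsto_ratio_of_kesten hν0 hb0 hlimb hiib hiiib
  rw [hν2] at hmain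
  have htwo : Tendsto (fun N : ℕ => 2 * N) atTop atTop :=
    tendsto_atTop_atTop.2 fun b => ⟨b, fun n hn => by omega⟩
  refine (hmain.comp htwo).congr fun N => ?_
  simp only [Function.comp, hb]
  congr 2 <;> omega

end Literature.Probability.RandomPlanarGeometry.SAW.Zd
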